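/-
Origin: expansion seat `planner-pub-hodgecm-pv06-g7-0`, handover #2 (CLAIM 2026-08-18T14:57:51Z; HANDOVER #2 2026-08-18T15:08:05Z) md5 e3b8000c8fc65b3e78247b17b6c1c7b4 (290 l.); additive KERNEL leaf (node N29 / seam S4: under pv05's polynomial Bargmann dictionary binv the printed Fock operator of the hyperbolic X1 at Folland's scaling i/pi is the symbol of the first-order vector field V = -Sum_a (x_a d/dy_a + y_a d/dx_a): binv_comp_printedHyp, hermiteFun_hypSym (`HOME/pub-hodgecm-pv06-g7/lean/Pv06g7/ArchCHyperbolicBargmann.lean`, md5 e3b8000c, 290 lines);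
landed by the gen-8 packager in gate run 31 as `HodgeCM/PerL34/ArchCHyperbolicBargmann.lean` (import ^import Pv06g7\.ArchCHyperbolic[ \t]*$→import HodgeCM.PerL34.ArchCHyperbolic ×1).
-/
/-
Copyright (c) 2026. Released under the Apache-2.0 license.
-/
import Summits.HodgeConjecture.HodgeCM.PerL34.ArchCHyperbolic
import Summits.HodgeConjecture.HodgeCM.PerL34.FockHermiteDict

/-!
# The hyperbolic direction under the polynomial Bargmann dictionary: a FIRST-ORDER operator (node N29, seam S4)

Origin: expansion seat `planner-pub-hodgecm-pv06-g7-0` (unit `pub-hodgecm-pv06-g7`, DAG-node prover #06 gen 7).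
WIP module `Pv06g7.ArchCHyperbolicBargmann`; intended final place `HodgeCM/PerL34/ArchCHyperbolicBargmann.lean`.
Imports: this seat's row #1 `Pv06g7.ArchCHyperbolic` (↦ `HodgeCM.PerL34.ArchCHyperbolic`, ONE rewrite) and the
TREE module `HodgeCM.PerL34.FockHermiteDict` (pv05-g5, gate run 27: Folland's symbol calculus `opX`, `opDel`, `opD`,
`opZ`, `opZs`, `hermiteFun`, `hasDerivAt_hermiteFun`, and the polynomial inverse Bargmann transform `binv` with
`binv_comp_mz`, `binv_comp_dz`).  Additive kernel leaf: asserts nothing, complete proofs, nothing cited enters as a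
hypothesis; every tree theorem is CALLED by name.

## What is proved (KERNEL)

Row #1 (`ArchCHyperbolic`) reduced the [SETUP D5′] input of Lemma 4.1(c) to ONE Schwartz-topology derivative per
place of type `Σ₁₂`, along `s ↦ ω(exp sX₁)`, `X₁ = E₀₁ + E₁₀ ∈ 𝔲(1,1)` hyperbolic, whose printed Fock operator on
`ℂ[z_a, w_a]` is `printedHyp λ = (i/λ)·(P·_) + iλ·Δ`, `Δ = Σ_a ∂_{z_a}∂_{w_a}` (pv12-g6's dictionary), and certified
by an abstract Weyl-algebra identity (`weyl_hyperbolic`) that this operator is first order "on the Schrödinger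
side".  THIS FILE makes that last clause a theorem about pv05's KERNEL Bargmann dictionary
([Fo89] = Folland 1989 §1.6–1.7, kernel-proved by pv05-g5 on the polynomial core):

* §1 `hyp_ring_identity` — in any ring, `d_i m_j = m_j d_i ⟹ (m_i − d_i)(m_j − d_j) − (m_i + d_i)(m_j + d_j)
  = −2(m_i d_j + m_j d_i)` (the abstract form of row #1's `weyl_hyperbolic`).
* §2 at **Folland's scaling `lamF := i/π`** (the value of `ψ(1) = λ` at which pv05's `binv` intertwines pv12's
  letters: `binv ∘ z_j = Z_j^* ∘ binv`, `binv ∘ ∂_{z_j} = π Z_j ∘ binv`):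
  `printedHyp_lamF : printedHyp lamF = π·(P·_) − π⁻¹·Δ`, `mulLeft_P : (P·_) = Σ_a z_a w_a` as operators, and
  **`binv_printedHyp : binv (H F) = hypSymb (binv F)`** / `binv_comp_printedHyp : binv ∘ₗ H = hypSymb ∘ₗ binv`,
  where **`hypSymb := −Σ_a (X_{x_a} ∘ ∂̂_{y_a} + X_{y_a} ∘ ∂̂_{x_a})`** is pv05's SYMBOL of the first-order
  differential operator `V := −Σ_a (x_a ∂/∂y_a + y_a ∂/∂x_a)` on the Hermite span `{p(x,y) e^{−π(|x|²+|y|²)}}`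
  (`opX` = symbol of multiplication by the coordinate, `opDel` = symbol of `∂/∂(coordinate)`, [Fo89 (1.81)]:
  pv05 `hermiteFun_opX`, `hasDerivAt_hermiteFun`).  The computation: `binv ∘ H = π Σ_a (Z*_{x_a} Z*_{y_a} −
  Z_{x_a} Z_{y_a}) ∘ binv` (`binv_comp_mz_mz`, `binv_comp_dz_dz`) and `π (Z*_i Z*_j − Z_i Z_j) = −(X_i ∂̂_j +
  X_j ∂̂_i)` for `i ≠ j` (`pi_smul_opZs_opZs_sub_opZ_opZ`, from §1 with `m = X`, `d = iD`, `D = (2πi)⁻¹∂̂`).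
* §3 **meaning on genuine functions** (`hermiteFun_hypSymb`): for every symbol `p` and point `v ∈ ℝ³ × ℝ³`,
  `(hypSymb p)(v) e^{−π|v|²} = −Σ_a ( x_a · ∂_{y_a}(p e^{−π|·|²})(v) + y_a · ∂_{x_a}(p e^{−π|·|²})(v) )`, the
  partial derivatives being honest `deriv`s along the coordinate lines (pv05 `hasDerivAt_hermiteFun`): `hypSymb`
  IS `V` on the Hermite span.  `V` is the generator of the LINEAR hyperbolic-rotation flow
  `R_s(x, y) = (x cosh s − y sinh s, y cosh s − x sinh s)` of `ℝ³ × ℝ³` (volume-preserving; in the coordinates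
  `x ± y` a pair of opposite dilations) — §4 records the matrix facts (`hypRot`, `hypRot_zero`, `hasDerivAt_hypRot`).

Consequently the ONE analytic clause left by row #1 at a `Σ₁₂` place reads, in the Schrödinger realisation matched
to the Fock letters by `binv`: "`s ↦ Φ ∘ R_{s}` is differentiable at `0` in `𝒮(ℝ⁶)` with derivative `VΦ`" for
`Φ` in the Hermite span — a Schwartz-topology derivative of a LINEAR FLOW, the class kernel-proved by pv14-g6
(`SchwartzLinearFlowDeriv`, `SchwartzWeightedFlowDeriv`, run 31) — composed with the identification of the
constructed `ω(exp sX₁)` with that flow (a property of the model, pv11-g9 ENDSTATE-S4-SPEC §3; NOT proved here).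

Relation to pv05-g7's Stone files (`FockStoneGenerator`, `FockStoneClosure`, run 31): those construct the generator of
`t ↦ ν₀(e^{tX})` on the Fock–Hilbert space for COMPACT `X ∈ 𝔲(σ)`; the hyperbolic `X₁` is not of that class (it
does not preserve degree: `P` raises it by 2, `Δ` lowers it by 2), which is why this file stays on the polynomial
core and identifies `X₁`'s operator with a vector field on the Schrödinger side instead.

Labels.  KERNEL: everything below.  PRINT (unchanged, unused as hypotheses): pv12-g6 (P1)(P3) (the polynomial model
IS `ω_{W,b}`), pv05 (P1b)(P1c) (unitarity of `B`, Folland Thm (4.45)/(4.49)).  PerL / QW8 / 2001 texts NOT cited.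
-/

set_option autoImplicit false

noncomputable section

namespace HodgeCM
namespace PerL34
namespace Fock
namespace PrintDict

open MvPolynomial Complex
open scoped BigOperators Real
open HodgeCM.PerL34.Fock.Hermite

/-! ## §1  The abstract identity -/

/-- In any ring: if `d_i` commutes with `m_j` then `(m_i − d_i)(m_j − d_j) − (m_i + d_i)(m_j + d_j) =
−2 (m_i d_j + m_j d_i)` (KERNEL; row #1's `weyl_hyperbolic` is the instance `m = z·`, `d = ∂_z`). -/
theorem hyp_ring_identity {R : Type*} [Ring R] (mi mj di dj : R) (h : di * mj = mj * di) :
    (mi - di) * (mj - dj) - (mi + di) * (mj + dj) = -(2 • (mi * dj + mj * di)) := by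
  rw [two_nsmul]
  simp only [sub_mul, mul_sub, add_mul, mul_add, h]
  abel

/-! ## §2  `binv ∘ H = V̂ ∘ binv` at Folland's scaling -/

/-- **Folland's scaling** `λ_F := i/π`: the value of Adams's `ψ(1) = λ` at which pv05's polynomial inverse Bargmann
transform `binv` ([Fo89 (1.78)]) intertwines pv12's Fock letters with Folland's `Z_j^*`, `πZ_j`. -/
def lamF : ℂ := I * (π : ℂ)⁻¹

/-- (Ported verbatim from the HodgeCMPerL package; no docstring in the source.) -/
theorem lamF_ne_zero : lamF ≠ 0 := mul_ne_zero I_ne_zero (inv_ne_zero pi_ne_zero')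

/-- (Ported verbatim from the HodgeCMPerL package; no docstring in the source.) -/
theorem I_mul_lamF_inv : I * lamF⁻¹ = (π : ℂ) := by
  rw [lamF, mul_inv, inv_inv, ← mul_assoc, Complex.mul_inv_cancel I_ne_zero, one_mul]

/-- (Ported verbatim from the HodgeCMPerL package; no docstring in the source.) -/
theorem I_mul_lamF : I * lamF = -(π : ℂ)⁻¹ := by
  rw [lamF, ← mul_assoc, I_mul_I, neg_one_mul]

/-- The lowering part of the dictionary: `Δ := Σ_a ∂_{z_a} ∂_{w_a}` on `ℂ[z, w]`. -/
def lapZW : Module.End ℂ MixedModel := ∑ a : Fin 3, dz (σ := MixedVar) (Sum.inl a) * dz (Sum.inr a)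

/-- `Δ F = Σ_a ∂_{z_a}(∂_{w_a} F)`. -/
theorem lapZW_apply (F : MixedModel) :
    lapZW F = ∑ a : Fin 3, dz (σ := MixedVar) (Sum.inl a) (dz (Sum.inr a) F) := by
  rw [lapZW, LinearMap.sum_apply]
  rfl

/-- `H(λ_F) F = π·(P F) − π⁻¹·(Δ F)`. -/
theorem printedHyp_lamF_apply (F : MixedModel) :
    printedHyp lamF F = (π : ℂ) • (P * F) - (π : ℂ)⁻¹ • lapZW F := by
  rw [printedHyp_eq_raise_add_lower, I_mul_lamF_inv, I_mul_lamF, LinearMap.add_apply, LinearMap.smul_apply,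
    LinearMap.smul_apply, LinearMap.mulLeft_apply, neg_smul, ← sub_eq_add_neg]
  rfl

/-- `H(λ_F) = π·(P·_) − π⁻¹·Δ` as operators. -/
theorem printedHyp_lamF : printedHyp lamF = (π : ℂ) • LinearMap.mulLeft ℂ P - (π : ℂ)⁻¹ • lapZW := by
  apply LinearMap.ext
  intro F
  rw [printedHyp_lamF_apply, LinearMap.sub_apply, LinearMap.smul_apply, LinearMap.smul_apply,
    LinearMap.mulLeft_apply]

/-- `P F = Σ_a z_a (w_a F)` (pv12's letters `mz`, Adams (2.7)). -/
theorem P_mul_eq (F : MixedModel) :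
    P * F = ∑ a : Fin 3, mz (σ := MixedVar) (Sum.inl a) (mz (Sum.inr a) F) := by
  rw [P, Finset.sum_mul]
  refine Finset.sum_congr rfl fun a _ => ?_
  rw [mz_apply, mz_apply, HodgeCM.PerL34.Fock.mz, HodgeCM.PerL34.Fock.mw, mul_assoc]

/-- `P·_ = Σ_a z_a w_a` as operators. -/
theorem mulLeft_P : LinearMap.mulLeft ℂ P = ∑ a : Fin 3, mz (σ := MixedVar) (Sum.inl a) * mz (Sum.inr a) := by
  apply LinearMap.ext
  intro F
  rw [LinearMap.mulLeft_apply, LinearMap.sum_apply, P_mul_eq]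
  rfl

section BinvDict

variable {σ : Type*} [Fintype σ] [DecidableEq σ]

/-- `binv ∘ (z_i z_j ·) = Z_i^* Z_j^* ∘ binv` (pv05 `binv_comp_mz`, twice). -/
theorem binv_comp_mz_mz (i j : σ) :
    binv ∘ₗ (mz i * mz j) = (opZs i * opZs j) ∘ₗ binv (σ := σ) := by
  rw [Module.End.mul_eq_comp, Module.End.mul_eq_comp, ← LinearMap.comp_assoc, binv_comp_mz,
    LinearMap.comp_assoc, binv_comp_mz, ← LinearMap.comp_assoc]

/-- `binv ∘ ∂_{z_i}∂_{z_j} = π² Z_i Z_j ∘ binv` (pv05 `binv_comp_dz`, twice). -/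
theorem binv_comp_dz_dz (i j : σ) :
    binv ∘ₗ (dz i * dz j) = ((π : ℂ) * π) • ((opZ i * opZ j) ∘ₗ binv (σ := σ)) := by
  rw [Module.End.mul_eq_comp, Module.End.mul_eq_comp, ← LinearMap.comp_assoc, binv_comp_dz,
    LinearMap.smul_comp, LinearMap.comp_assoc, binv_comp_dz, LinearMap.comp_smul, smul_smul,
    ← LinearMap.comp_assoc]

omit [Fintype σ] in
/-- On symbols, `∂̂_i` commutes with `X_j` for `i ≠ j` (pv05 `pderiv_X_mul`). -/
theorem opDel_mul_opX_of_ne {i j : σ} (h : i ≠ j) : opDel i * opX j = opX j * opDel i := by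
  apply LinearMap.ext
  intro p
  simp only [Module.End.mul_apply, opX_apply, opDel_apply, pderiv_X_mul, if_neg h, add_zero, mul_sub,
    smul_eq_C_mul]
  ring

omit [Fintype σ] in
/-- … hence so does Folland's `D_i = (2πi)⁻¹ ∂̂_i`. -/
theorem I_smul_opD_mul_opX_of_ne {i j : σ} (h : i ≠ j) : (I • opD i) * opX j = opX j * (I • opD i) := by
  rw [opD, smul_smul, smul_mul_assoc, mul_smul_comm, opDel_mul_opX_of_ne h]

omit [Fintype σ] [DecidableEq σ] in
/-- `X_i ∘ (iD_j) = (2π)⁻¹ X_i ∂̂_j` (pv05 `I_mul_inv_two_pi_I`). -/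
theorem opX_mul_I_smul_opD (i j : σ) : opX i * (I • opD j) = (2 * π : ℂ)⁻¹ • (opX i * opDel j) := by
  rw [opD, smul_smul, I_mul_inv_two_pi_I, mul_smul_comm]

omit [Fintype σ] in
/-- **The symbol identity**: `π (Z_i^* Z_j^* − Z_i Z_j) = −(X_i ∂̂_j + X_j ∂̂_i)` for `i ≠ j` (§1 with `m = X`,
`d = iD`). -/
theorem pi_smul_opZs_opZs_sub_opZ_opZ {i j : σ} (h : i ≠ j) :
    (π : ℂ) • (opZs i * opZs j - opZ i * opZ j) = -(opX i * opDel j + opX j * opDel i) := by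
  have key := hyp_ring_identity (opX i) (opX j) (I • opD i) (I • opD j) (I_smul_opD_mul_opX_of_ne h)
  rw [opZs, opZs, opZ, opZ, key, opX_mul_I_smul_opD, opX_mul_I_smul_opD, ← smul_add, smul_neg, two_nsmul,
    ← two_smul ℂ, smul_smul, smul_smul, neg_inj]
  rw [show (π : ℂ) * 2 * (2 * π : ℂ)⁻¹ = 1 by rw [mul_comm (π : ℂ) 2, Complex.mul_inv_cancel two_pi_ne_zero],
    one_smul]

end BinvDict

/-- **The symbol of the hyperbolic vector field** `V = −Σ_a (x_a ∂/∂y_a + y_a ∂/∂x_a)` on the Hermite span of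
`ℝ³ × ℝ³` (pv05's letters: `opX` = symbol of the coordinate multiplication, `opDel` = symbol of `∂/∂(coordinate)`). -/
def hypSymb : Module.End ℂ (MvPolynomial MixedVar ℂ) :=
  -∑ a : Fin 3, (opX (Sum.inl a) * opDel (Sum.inr a) + opX (Sum.inr a) * opDel (Sum.inl a))

/-- **`B⁻¹ H = V̂ B⁻¹` on the polynomial core (KERNEL)**: pv05's inverse Bargmann dictionary carries the printed
Fock operator of the hyperbolic element `X₁` (at Folland's scaling) to the symbol of the first-order operator `V`. -/
theorem binv_printedHyp (F : MixedModel) : binv (printedHyp lamF F) = hypSymb (binv F) := by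
  have hmz : ∀ a : Fin 3, binv (mz (σ := MixedVar) (Sum.inl a) (mz (Sum.inr a) F)) =
      opZs (Sum.inl a) (opZs (Sum.inr a) (binv F)) := fun a => by
    simpa only [LinearMap.comp_apply, Module.End.mul_apply] using
      LinearMap.congr_fun (binv_comp_mz_mz (σ := MixedVar) (Sum.inl a) (Sum.inr a)) F
  have hdz : ∀ a : Fin 3, binv (dz (σ := MixedVar) (Sum.inl a) (dz (Sum.inr a) F)) =
      ((π : ℂ) * π) • opZ (Sum.inl a) (opZ (Sum.inr a) (binv F)) := fun a => by
    simpa only [LinearMap.comp_apply, LinearMap.smul_apply, Module.End.mul_apply] using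
      LinearMap.congr_fun (binv_comp_dz_dz (σ := MixedVar) (Sum.inl a) (Sum.inr a)) F
  have hsymb : ∀ a : Fin 3, (π : ℂ) • (opZs (Sum.inl a) (opZs (Sum.inr a) (binv F)) -
      opZ (Sum.inl a) (opZ (Sum.inr a) (binv F))) =
      -((opX (Sum.inl a) * opDel (Sum.inr a) + opX (Sum.inr a) * opDel (Sum.inl a) :
          Module.End ℂ (MvPolynomial MixedVar ℂ)) (binv F)) := fun a => by
    simpa only [LinearMap.smul_apply, LinearMap.sub_apply, LinearMap.neg_apply, Module.End.mul_apply] using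
      LinearMap.congr_fun (pi_smul_opZs_opZs_sub_opZ_opZ (σ := MixedVar) (Sum.inl_ne_inr (a := a) (b := a)))
        (binv F)
  rw [printedHyp_lamF_apply, P_mul_eq, lapZW_apply, map_sub, map_smul, map_smul, map_sum, map_sum,
    Finset.smul_sum, Finset.smul_sum, ← Finset.sum_sub_distrib, hypSymb, LinearMap.neg_apply,
    LinearMap.sum_apply, ← Finset.sum_neg_distrib]
  refine Finset.sum_congr rfl fun a _ => ?_
  rw [hmz, hdz, ← hsymb, smul_sub, smul_smul,
    show (π : ℂ)⁻¹ * (π * π) = π by rw [← mul_assoc, inv_mul_cancel₀ pi_ne_zero', one_mul]]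

/-- The same as an identity of linear maps `ℂ[z, w] → ℂ[x, y]`. -/
theorem binv_comp_printedHyp : binv ∘ₗ printedHyp lamF = hypSymb ∘ₗ binv (σ := MixedVar) :=
  LinearMap.ext binv_printedHyp

/-! ## §3  Meaning on the genuine functions `p(v) e^{−π|v|²}` -/

section Meaning

variable {σ : Type*} [Fintype σ]

/-- (Ported verbatim from the HodgeCMPerL package; no docstring in the source.) -/
theorem hermiteFun_neg' (p : MvPolynomial σ ℂ) (x : σ → ℝ) : hermiteFun (-p) x = -hermiteFun p x := by
  simp [hermiteFun, neg_mul]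

/-- (Ported verbatim from the HodgeCMPerL package; no docstring in the source.) -/
theorem hermiteFun_sum {ι : Type*} (s : Finset ι) (p : ι → MvPolynomial σ ℂ) (x : σ → ℝ) :
    hermiteFun (∑ i ∈ s, p i) x = ∑ i ∈ s, hermiteFun (p i) x := by
  simp [hermiteFun, map_sum, Finset.sum_mul]

end Meaning

/-- **`V̂` IS `V` on the Hermite span (KERNEL)**: for every symbol `p` and every point `v = (x, y) ∈ ℝ³ × ℝ³`,
`(V̂p)(v)·e^{−π|v|²} = −Σ_a ( x_a · ∂_{y_a}[p e^{−π|·|²}](v) + y_a · ∂_{x_a}[p e^{−π|·|²}](v) )`, the partial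
derivatives being `deriv`s along the coordinate lines through `v` (pv05 `hasDerivAt_hermiteFun`). -/
theorem hermiteFun_hypSymb (p : MvPolynomial MixedVar ℂ) (v : MixedVar → ℝ) :
    hermiteFun (hypSymb p) v =
      -∑ a : Fin 3, ((v (Sum.inl a) : ℂ) * deriv (fun t : ℝ => hermiteFun p (Function.update v (Sum.inr a) t))
          (v (Sum.inr a)) +
        (v (Sum.inr a) : ℂ) * deriv (fun t : ℝ => hermiteFun p (Function.update v (Sum.inl a) t))
          (v (Sum.inl a))) := by
  rw [hypSymb, LinearMap.neg_apply, hermiteFun_neg', LinearMap.sum_apply, hermiteFun_sum]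
  refine congrArg Neg.neg (Finset.sum_congr rfl fun a _ => ?_)
  rw [LinearMap.add_apply, hermiteFun_add, Module.End.mul_apply, Module.End.mul_apply, hermiteFun_opX,
    hermiteFun_opX, (hasDerivAt_hermiteFun p v (Sum.inr a)).deriv, (hasDerivAt_hermiteFun p v (Sum.inl a)).deriv]

/-! ## §4  The flow: the hyperbolic rotation of `ℝ³ × ℝ³` -/

/-- The hyperbolic rotation `R_s (x, y) = (x cosh s − y sinh s, y cosh s − x sinh s)` of `ℝ³ × ℝ³` — the flow of the
vector field `v ↦ (−y, −x)` whose Lie derivative on functions is `V = −Σ_a (x_a∂_{y_a} + y_a∂_{x_a})`; in the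
coordinates `x ± y` it is the pair of dilations `e^{∓s}` (row #1 `hypMat_mulVec_isotropic_plus/minus`). -/
def hypRot (s : ℝ) (v : MixedVar → ℝ) : MixedVar → ℝ
  | Sum.inl a => Real.cosh s * v (Sum.inl a) - Real.sinh s * v (Sum.inr a)
  | Sum.inr a => Real.cosh s * v (Sum.inr a) - Real.sinh s * v (Sum.inl a)

/-- (Ported verbatim from the HodgeCMPerL package; no docstring in the source.) -/
theorem hypRot_zero (v : MixedVar → ℝ) : hypRot 0 v = v := by
  funext k
  cases k <;> simp [hypRot]

/-- The velocity of the flow at `s = 0`: `d/ds R_s(v)|₀ = (−y, −x)` coordinatewise (KERNEL, Mathlib calculus). -/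
theorem hasDerivAt_hypRot (v : MixedVar → ℝ) (k : MixedVar) :
    HasDerivAt (fun s : ℝ => hypRot s v k)
      (match k with | Sum.inl a => -v (Sum.inr a) | Sum.inr a => -v (Sum.inl a)) 0 := by
  cases k with
  | inl a =>
    have h := ((Real.hasDerivAt_cosh 0).mul_const (v (Sum.inl a))).sub
      ((Real.hasDerivAt_sinh 0).mul_const (v (Sum.inr a)))
    simp only [Real.sinh_zero, zero_mul, Real.cosh_zero, one_mul, zero_sub] at h
    exact h
  | inr a =>
    have h := ((Real.hasDerivAt_cosh 0).mul_const (v (Sum.inr a))).sub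
      ((Real.hasDerivAt_sinh 0).mul_const (v (Sum.inl a)))
    simp only [Real.sinh_zero, zero_mul, Real.cosh_zero, one_mul, zero_sub] at h
    exact h

/-- The flow is by LINEAR maps. -/
theorem hypRot_add (s : ℝ) (v w : MixedVar → ℝ) : hypRot s (v + w) = hypRot s v + hypRot s w := by
  funext k
  cases k <;> simp [hypRot] <;> ring

/-- (Ported verbatim from the HodgeCMPerL package; no docstring in the source.) -/
theorem hypRot_smul (s c : ℝ) (v : MixedVar → ℝ) : hypRot s (c • v) = c • hypRot s v := by
  funext k
  cases k <;> simp [hypRot] <;> ring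

end PrintDict
end Fock
end PerL34
end HodgeCM

end
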